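import Mathlib.Analysis.SpecialFunctions.Pow.Real
import Mathlib.Analysis.SpecialFunctions.Log.Deriv
import Mathlib.Algebra.Order.BigOperators.Group.Finset
import HarnessLib

/-!
# Log-form assembly of per-orbit Laplace tube estimates (layer (D) of the DIRECT Laplace road to ⟨stmt-QuantumFields-24204⟩)

Helper module (free-hands work of width seat ym-line-sfw-p2-w2 g49, cell ym-idea-1), generic real analysis consumed BY NAME by the
assembly step (d) of memo `DIRECT-LAPLACE-24204-v4.md` §4∕§8:
* `abs_log_sub_log_le_of_abs_sub_le` — `0 < G`, `|I − G| ≤ tG`, `t ≤ 1/2` ⇒ `0 < I` and `|log I − log G| ≤ 2t`;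
* `log_mul_rpow_div` — `log(Λ·(2π/β)^d) = log Λ + d·log(2π) − d·log β`;
* ★ `abs_log_sub_asymptotic_le` (Finset form) ∕ ★ `abs_log_sub_asymptotic_le_of_sum_of_tubes` (Fintype form, hypotheses literally the
  output shape of ✓`laplaceMethod_quantitative_sum_of_tubes` fed with the per-tube main terms `ℓ_a = c_a(2π/β)^d` and errors
  `ε_a = (K_a/β)ℓ_a` of ✓`laplaceMethod_quantitative_orbit_tube`): if moreover the off-tube remainder is `≤ (1/β)·(Σ c_a)(2π/β)^d` and
  `(K_max+1)/β ≤ 1/2`, then `|log I − (log Σ_a c_a + d·log 2π − d·log β)| ≤ 2(K_max+1)/β`;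
* `mul_exp_neg_le_main_div` — the window condition in closed form: `log M − log Λ − d·log 2π + (d+1)·log β ≤ βη` ⇒
  `M·e^{−βη} ≤ (1/β)·Λ(2π/β)^d` (this is where `L ≤ β^a` enters: `d = 9L⁴`, `η ≥ 1/poly(L)`, `log M, |log Λ| ≤ poly(L)`).
Everything is PROVED; no definitions, no named facts.  HONEST FRAMING: elementary real analysis; ⟨24204⟩, ⟨24319⟩ and every rung stay
OPEN; the Yang–Mills mass gap (Clay) is NOT touched; no summit is proved by a line.
-/

noncomputable section

open Real Finset
open scoped BigOperators

namespace Summit.QuantumFields.YangMills.Theorems.QuantitativeLaplace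

/-- If `0 < G`, `|I − G| ≤ t·G` and `t ≤ 1/2`, then `0 < I` and `|log I − log G| ≤ 2t`. [folklore] -/
theorem abs_log_sub_log_le_of_abs_sub_le {I G t : ℝ} (hG : 0 < G) (ht : t ≤ 1 / 2) (h : |I - G| ≤ t * G) :
    0 < I ∧ |Real.log I - Real.log G| ≤ 2 * t := by
  have huabs : |(I - G) / G| ≤ t := by
    rw [abs_div, abs_of_pos hG, div_le_iff₀ hG]; exact h
  have hu2 : |(I - G) / G| ≤ 1 / 2 := huabs.trans ht
  have h1u : 0 < 1 + (I - G) / G := by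
    have := neg_abs_le ((I - G) / G)
    linarith
  have hIu : I = G * (1 + (I - G) / G) := by field_simp; ring
  refine ⟨by rw [hIu]; exact mul_pos hG h1u, ?_⟩
  rw [hIu, Real.log_mul hG.ne' h1u.ne', add_sub_cancel_left]
  -- `|log(1+u)| ≤ |u|/(1−|u|) ≤ 2|u|` for `|u| ≤ 1/2` (Mathlib's `Real.abs_log_sub_add_sum_range_le` with `n = 0`;
  -- the same inequality is `Literature.NumberTheory.Sieve.BombieriSieve.abs_log_one_add_le`, not imported to keep this file light)
  have hlog1 : |Real.log (1 + (I - G) / G)| ≤ 2 * |(I - G) / G| := by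
    have h1 : |(-((I - G) / G))| < 1 := by rw [abs_neg]; linarith
    have h := Real.abs_log_sub_add_sum_range_le h1 0
    simp only [Finset.range_zero, Finset.sum_empty, zero_add, sub_neg_eq_add, abs_neg, pow_one] at h
    calc |Real.log (1 + (I - G) / G)| ≤ |(I - G) / G| / (1 - |(I - G) / G|) := h
      _ ≤ |(I - G) / G| / (1 / 2) := div_le_div_of_nonneg_left (abs_nonneg _) (by norm_num) (by linarith)
      _ = 2 * |(I - G) / G| := by ring
  linarith

/-- The Gaussian main term in logarithmic form: `log(Λ·(2π/β)^d) = log Λ + d·log(2π) − d·log β`. [folklore] -/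
theorem log_mul_rpow_div (Λ d β : ℝ) (hΛ : 0 < Λ) (hβ : 0 < β) :
    Real.log (Λ * (2 * π / β) ^ d) = Real.log Λ + d * Real.log (2 * π) - d * Real.log β := by
  have h2 : (0 : ℝ) < 2 * π / β := by positivity
  rw [Real.log_mul hΛ.ne' (Real.rpow_pos_of_pos h2 d).ne', Real.log_rpow h2,
    Real.log_div (by positivity) hβ.ne']
  ring

/-- ★ **Log-form assembly** (Finset form): per-orbit tube estimates `|I_a − c_a g| ≤ (K_a/β)c_a g`, `g = (2π/β)^d`, an off-tube
remainder `E ≤ (1/β)(Σc_a)g` and `(K_max+1)/β ≤ 1/2` give `|log I − (log Σc_a + d log 2π − d log β)| ≤ 2(K_max+1)/β`.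
[cite: Breitung1994, Thm 41 p. 56 and Thm 56 (6.31)] -/
theorem abs_log_sub_asymptotic_le {ι : Type*} (s : Finset ι) {I c K : ι → ℝ} {Itot E Kmax d β : ℝ}
    (hβ : 0 < β) (hs : s.Nonempty) (hc : ∀ a ∈ s, 0 < c a) (hK : ∀ a ∈ s, K a ≤ Kmax)
    (hI : ∀ a ∈ s, |I a - c a * (2 * π / β) ^ d| ≤ K a / β * (c a * (2 * π / β) ^ d))
    (hE : |Itot - ∑ a ∈ s, I a| ≤ E) (hEle : E ≤ 1 / β * ((∑ a ∈ s, c a) * (2 * π / β) ^ d))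
    (hsmall : (Kmax + 1) / β ≤ 1 / 2) :
    0 < Itot ∧
      |Real.log Itot - (Real.log (∑ a ∈ s, c a) + d * Real.log (2 * π) - d * Real.log β)| ≤ 2 * (Kmax + 1) / β := by
  set g : ℝ := (2 * π / β) ^ d with hg
  have hgpos : 0 < g := Real.rpow_pos_of_pos (by positivity) d
  have hΛpos : 0 < ∑ a ∈ s, c a := Finset.sum_pos hc hs
  have hG : 0 < (∑ a ∈ s, c a) * g := mul_pos hΛpos hgpos
  have hsum : |∑ a ∈ s, I a - (∑ a ∈ s, c a) * g| ≤ Kmax / β * ((∑ a ∈ s, c a) * g) := by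
    have e : ∑ a ∈ s, I a - (∑ a ∈ s, c a) * g = ∑ a ∈ s, (I a - c a * g) := by
      rw [Finset.sum_sub_distrib, Finset.sum_mul]
    rw [e]
    calc |∑ a ∈ s, (I a - c a * g)| ≤ ∑ a ∈ s, |I a - c a * g| := Finset.abs_sum_le_sum_abs _ _
      _ ≤ ∑ a ∈ s, Kmax / β * (c a * g) := Finset.sum_le_sum fun a ha => (hI a ha).trans
            (mul_le_mul_of_nonneg_right (div_le_div_of_nonneg_right (hK a ha) hβ.le)
              (mul_pos (hc a ha) hgpos).le)
      _ = Kmax / β * ((∑ a ∈ s, c a) * g) := by rw [← Finset.mul_sum, ← Finset.sum_mul]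
  have htot : |Itot - (∑ a ∈ s, c a) * g| ≤ (Kmax + 1) / β * ((∑ a ∈ s, c a) * g) := by
    have e : Itot - (∑ a ∈ s, c a) * g = (Itot - ∑ a ∈ s, I a) + (∑ a ∈ s, I a - (∑ a ∈ s, c a) * g) := by ring
    calc |Itot - (∑ a ∈ s, c a) * g|
        = |(Itot - ∑ a ∈ s, I a) + (∑ a ∈ s, I a - (∑ a ∈ s, c a) * g)| := by rw [← e]
      _ ≤ |Itot - ∑ a ∈ s, I a| + |∑ a ∈ s, I a - (∑ a ∈ s, c a) * g| := abs_add_le _ _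
      _ ≤ E + Kmax / β * ((∑ a ∈ s, c a) * g) := add_le_add hE hsum
      _ ≤ 1 / β * ((∑ a ∈ s, c a) * g) + Kmax / β * ((∑ a ∈ s, c a) * g) := by linarith [hEle]
      _ = (Kmax + 1) / β * ((∑ a ∈ s, c a) * g) := by ring
  obtain ⟨hpos, hlog⟩ := abs_log_sub_log_le_of_abs_sub_le hG hsmall htot
  refine ⟨hpos, ?_⟩
  calc |Real.log Itot - (Real.log (∑ a ∈ s, c a) + d * Real.log (2 * π) - d * Real.log β)|
      = |Real.log Itot - Real.log ((∑ a ∈ s, c a) * g)| := by rw [hg, log_mul_rpow_div _ d β hΛpos hβ]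
    _ ≤ 2 * ((Kmax + 1) / β) := hlog
    _ = 2 * (Kmax + 1) / β := by ring

/-- ★ **Log-form assembly, `Fintype` form** — hypotheses literally in the output shape of ✓`laplaceMethod_quantitative_sum_of_tubes`
with `ℓ_a = c_a(2π/β)^d`, `ε_a = (K_a/β)ℓ_a` and off-tube constant `M`: if `M·ρ(Y) ≤ (1/β)(Σ_a c_a)(2π/β)^d` and `(K_max+1)/β ≤ 1/2`
then `0 < ∫F` and `|log ∫F − (log Σ_a c_a + d·log 2π − d·log β)| ≤ 2(K_max+1)/β`. [cite: Breitung1994, Thm 56 (6.31)] -/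
theorem abs_log_sub_asymptotic_le_of_sum_of_tubes {ι : Type*} [Fintype ι] [Nonempty ι] {c K : ι → ℝ}
    {Itot Mρ Kmax d β : ℝ} (hβ : 0 < β) (hc : ∀ a, 0 < c a) (hK : ∀ a, K a ≤ Kmax)
    (hI : |Itot - ∑ a, c a * (2 * π / β) ^ d| ≤ (∑ a, K a / β * (c a * (2 * π / β) ^ d)) + Mρ)
    (hM : Mρ ≤ 1 / β * ((∑ a, c a) * (2 * π / β) ^ d)) (hsmall : (Kmax + 1) / β ≤ 1 / 2) :
    0 < Itot ∧
      |Real.log Itot - (Real.log (∑ a, c a) + d * Real.log (2 * π) - d * Real.log β)| ≤ 2 * (Kmax + 1) / β := by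
  set g : ℝ := (2 * π / β) ^ d with hg
  have hgpos : 0 < g := Real.rpow_pos_of_pos (by positivity) d
  have hΛpos : 0 < ∑ a, c a := Finset.sum_pos (fun a _ => hc a) Finset.univ_nonempty
  have hG : 0 < (∑ a, c a) * g := mul_pos hΛpos hgpos
  have hsum : ∑ a, K a / β * (c a * g) ≤ Kmax / β * ((∑ a, c a) * g) := by
    calc ∑ a, K a / β * (c a * g) ≤ ∑ a, Kmax / β * (c a * g) := Finset.sum_le_sum fun a _ =>
            mul_le_mul_of_nonneg_right (div_le_div_of_nonneg_right (hK a) hβ.le) (mul_pos (hc a) hgpos).le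
      _ = Kmax / β * ((∑ a, c a) * g) := by rw [← Finset.mul_sum, ← Finset.sum_mul]
  have htot : |Itot - (∑ a, c a) * g| ≤ (Kmax + 1) / β * ((∑ a, c a) * g) := by
    have e : ∑ a, c a * g = (∑ a, c a) * g := by rw [Finset.sum_mul]
    rw [← e]
    calc |Itot - ∑ a, c a * g| ≤ (∑ a, K a / β * (c a * g)) + Mρ := hI
      _ ≤ Kmax / β * ((∑ a, c a) * g) + 1 / β * ((∑ a, c a) * g) := add_le_add hsum hM
      _ = (Kmax + 1) / β * (∑ a, c a * g) := by rw [e]; ring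
  obtain ⟨hpos, hlog⟩ := abs_log_sub_log_le_of_abs_sub_le hG hsmall htot
  refine ⟨hpos, ?_⟩
  calc |Real.log Itot - (Real.log (∑ a, c a) + d * Real.log (2 * π) - d * Real.log β)|
      = |Real.log Itot - Real.log ((∑ a, c a) * g)| := by rw [hg, log_mul_rpow_div _ d β hΛpos hβ]
    _ ≤ 2 * ((Kmax + 1) / β) := hlog
    _ = 2 * (Kmax + 1) / β := by ring

/-- **The window condition in closed form**: `log M − log Λ − d·log(2π) + (d+1)·log β ≤ βη` ⇒ `M·e^{−βη} ≤ (1/β)·Λ·(2π/β)^d`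
(how `L ≤ β^a` enters the leaf: `d = 9L⁴`, `η ≥ 1/poly(L)`, `log M, |log Λ| ≤ poly(L)`). [folklore] -/
theorem mul_exp_neg_le_main_div {M η Λ d β : ℝ} (hM : 0 < M) (hΛ : 0 < Λ) (hβ : 0 < β)
    (h : Real.log M - Real.log Λ - d * Real.log (2 * π) + (d + 1) * Real.log β ≤ β * η) :
    M * Real.exp (-(β * η)) ≤ 1 / β * (Λ * (2 * π / β) ^ d) := by
  have hR : 0 < 1 / β * (Λ * (2 * π / β) ^ d) :=
    mul_pos (by positivity) (mul_pos hΛ (Real.rpow_pos_of_pos (by positivity) d))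
  rw [← Real.log_le_log_iff (mul_pos hM (Real.exp_pos _)) hR, Real.log_mul hM.ne' (Real.exp_pos _).ne', Real.log_exp,
    Real.log_mul (by positivity) (mul_pos hΛ (Real.rpow_pos_of_pos (by positivity) d)).ne',
    log_mul_rpow_div Λ d β hΛ hβ, Real.log_div one_ne_zero hβ.ne', Real.log_one]
  linarith

end Summit.QuantumFields.YangMills.Theorems.QuantitativeLaplace
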